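import Summits.QuantumFields.QCD.Theorems.QuarksAsStableActionStableActionBridgeDressedTransfer

/-!
# Dressed form of the one-step matrix with two temporal transporters
(crux `QuarksAsStableAction.StableActionBridge`, item stmt-QuantumFields-9737, line `Sketch`; lead helper of
continuation lead c3, cycle 4, `--supports stmt-QuantumFields-9737`; registered sub-goal
`neg_explicitInv_mul_eq_dressed_two`)

The landed `neg_explicitInv_mul_eq_dressed` (p119952) writes the one-step matrix `−Ẽ F` of the time-slice
reduction of the Wilson fermion determinant as Lüscher's positive core dressed by ONE transporter `W`.  In the
Wilson instance the explicit inverse `Ẽ_t = −W_{t−1} P⁺ + W_{t−1} P⁺ C_t Bh_t⁻¹ P⁻ + Bh_t⁻¹ P⁻` of the chain block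
`E_t = A_t P⁻ − P⁺ W′_{t−1}` carries the temporal links of slice `t − 1`, while `F_t = A_t P⁺ − P⁻ W_t` carries
those of slice `t`; this file proves the same identity with two independent transporters,

  `−Ẽ F = (W₁ P⁺ + P⁻) · (1 + P⁺ C P⁻)(Bh P⁺ + Bh⁻¹ P⁻)(1 − P⁻ C P⁺) · (P⁺ + W₂ P⁻)`,

for `Ẽ = −W₁ P⁺ + W₁ P⁺ C Bh⁻¹ P⁻ + Bh⁻¹ P⁻`, `F = (Bh + C) P⁺ − P⁻ W₂`.  Only `W₂ P⁻ = P⁻ W₂` is needed of the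
transporters (no hypothesis on `W₁` at all).  The proof is the two-pass monomial normalisation of p119952.
[cite: Luscher1977, pp. 283–292]
-/

namespace Summit.QuantumFields.QCD.Cruxes.StableActionBridge.Sketch

open scoped ComplexOrder
open Literature.MathematicalPhysics.QuantumFieldTheory Literature.MathematicalPhysics.QuantumLattice

/-- **Dressed form of the one-step matrix, two transporters** (registered sub-goal
`neg_explicitInv_mul_eq_dressed_two` of crux stmt-QuantumFields-9737): for mutually annihilating idempotents `Pp`,
`Pm`, an invertible `Bh` commuting with both, a hopping part `C` with `Pp C Pp = 0`, an arbitrary `W₁` and a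
transporter `W₂` commuting with `Pm`,
`−(−W₁ Pp + W₁ Pp C Bh⁻¹ Pm + Bh⁻¹ Pm)((Bh + C) Pp − Pm W₂) = (W₁ Pp + Pm)(1 + Pp C Pm)(Bh Pp + Bh⁻¹ Pm)(1 − Pm C Pp)(Pp + W₂ Pm)`.
[cite: Luscher1977, pp. 283–292] -/
theorem neg_explicitInv_mul_eq_dressed_two :
    ∀ (n : Type) [Fintype n] [DecidableEq n] (Pp Pm Bh C W₁ W₂ : Matrix n n ℂ),
      Pp * Pp = Pp → Pm * Pm = Pm → Pp * Pm = 0 → Pm * Pp = 0 →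
      Bh * Pp = Pp * Bh → Bh * Pm = Pm * Bh → Pp * C * Pp = 0 → W₂ * Pm = Pm * W₂ → IsUnit Bh.det →
      -((-(W₁ * Pp) + W₁ * Pp * C * Bh⁻¹ * Pm + Bh⁻¹ * Pm) * ((Bh + C) * Pp - Pm * W₂)) =
        (W₁ * Pp + Pm) * ((1 + Pp * C * Pm) * (Bh * Pp + Bh⁻¹ * Pm) * (1 - Pm * C * Pp)) *
          (Pp + W₂ * Pm) := by
  intro n _ _ Pp Pm Bh C W₁ W₂ hPP hQQ hPQ hQP hBP hBQ hPCP hWQ hBh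
  -- `Bh⁻¹` commutes with `Pm`
  have hIQ : Bh⁻¹ * Pm = Pm * Bh⁻¹ := DressedTransfer.nonsing_inv_mul_comm hBh hBQ
  -- tail form of the vanishing triple product
  have hPCP' : Pp * (C * Pp) = 0 := by rw [← Matrix.mul_assoc, hPCP]
  -- step 1: distribute into right-associated monomials
  simp only [Matrix.mul_add, Matrix.add_mul, Matrix.mul_sub, Matrix.sub_mul, neg_mul,
    Matrix.one_mul, Matrix.mul_one, Matrix.mul_assoc, neg_sub]
  -- step 2: normalise each monomial from the right
  simp only [hPP, hQP, hBP, hWQ, hPCP', DressedTransfer.mul_mul_eq hPP,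
    DressedTransfer.mul_mul_eq hQQ, DressedTransfer.mul_mul_eq hPQ, DressedTransfer.mul_mul_eq hQP,
    DressedTransfer.mul_mul_comm hIQ,
    Matrix.mul_zero, Matrix.zero_mul, neg_zero, add_zero, zero_add, sub_zero]
  abel

end Summit.QuantumFields.QCD.Cruxes.StableActionBridge.Sketch
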